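import Summits.ValiantsHypothesis.ValiantsHypothesis.Theorems.LacunarySymmetroidMatrixDescartesCensusDoorA34NullNullHiddenTypes
import Summits.ValiantsHypothesis.ValiantsHypothesis.Theorems.LacunarySymmetroidMatrixDescartesCensusDoorA34SingularLetterAdjugateCell

/-!
# `MatrixDescartes` census — DOOR A at `(3,4)`: the PINNED END-EDGE law on the null-null sheet — a hidden-definite middle letter against the OTHER singular end letter,
# whose cell (⪰ 0, ⪯ 0, indefinite) fixes the signs of the two quadratic-edge slots; plus «adj S ⪰ 0 ⇒ S semidefinite» for symmetric `3 × 3` matrices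

HONEST FRAMING.  Object-search cell `pub-symmetroid`, engine seat `val-sym-eng-2` (g5); helper rows beside the registered strata line
`Cruxes/DoorA34/Lines/strata.lean` on stmt-ValiantsHypothesis-19980 (`DoorA34 = PosRootLawAt 3 4 18`: OPEN, typed, never asserted here); third stub `stub_nullNullCeiling`.
For a definite middle letter `S_x = s·N` (`N ≻ 0`) and a singular end letter `S_e`: `c_{xxe} = tr(adj S_x·S_e)` is `> 0 / < 0` when `S_e ⪰ 0 / ⪯ 0`, and
`c_{xee} = tr(adj S_e·S_x)` has the sign `s` when `S_e` is semidefinite and `−s` when `S_e` is indefinite (then `−adj S_e ⪰ 0`).  On a null-null seventeen read from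
the end `S_E ⪰ 0` (`E = 3` top, `E = 0` bottom) the sign `s` is that of `c_{EEx}` and all signs are parities of the sheet rank — the test is decidable:

* **`posSemidef_or_neg_of_adjugate_posSemidef`** (symmetric `3 × 3`: `adj S ⪰ 0 ⇒ S ⪰ 0 ∨ S ⪯ 0`, by the Lagrange–adjugate identity: every `2`-plane Gram determinant of
  `S` is a value of the adjugate form), `neg_adjugate_posSemidef_of_not_semidef` (singular, not semidefinite ⇒ `−adj S ⪰ 0`);
* `trace_adjugate_mul_nonneg_of_posDef_posSemidef`, `trace_adjugate_mul_nonneg_of_posSemidef_posDef`, `trace_adjugate_mul_nonpos_of_negCell_posDef` (sign facts);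
* **`card_posRoots_le_16_of_nullNull_topEndEdgeTest`** (pinning end `S₃ ⪰ 0`, edge end `S₀` in a given cell) and **`…bottomEndEdgeTest`** (pinning end `S₀ ⪰ 0`, edge end `S₃`);
  the `⪯ 0` pinning ends follow by `S ↦ −S` (pattern of …NullNullEndTests; not restated).  In the seat's atlas these are the L4 kills «definite middle letter vs a
  singular end».

Nothing here bounds anything else; `DoorA34` and the three stubs stay OPEN; registers unchanged; nothing on `MatrixDescartes` (stmt-ValiantsHypothesis-18050) or `VP ≠ VNP` —
VP≠VNP not moved.  [folklore] Elementary.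
-/

-- `Summit.ValiantsHypothesis.ValiantsHypothesis.…` repeats a component by the D-0017 layout
-- (single-conjunct summit), which the `dupNamespace` linter flags; the name is mandated.
set_option linter.dupNamespace false

namespace Summit.ValiantsHypothesis.ValiantsHypothesis.Theorems.LacunarySymmetroidMatrixDescartes.Census

open Polynomial Finset Matrix
open scoped BigOperators Polynomial Matrix

/-! ## 1. `adj S ⪰ 0 ⇒ S` semidefinite -/

/-- **A symmetric `3 × 3` matrix with positive semidefinite adjugate is semidefinite (of one sign).**  For any `x, y`:
`(xᵀSx)(yᵀSy) − (xᵀSy)² = (x × y)ᵀ adj(S) (x × y) ≥ 0`, so no two vectors give values of opposite signs. [folklore] -/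
theorem posSemidef_or_neg_of_adjugate_posSemidef (S : Matrix (Fin 3) (Fin 3) ℝ) (hS : S.IsSymm) (hadj : S.adjugate.PosSemidef) :
    S.PosSemidef ∨ (-S).PosSemidef := by
  have gram : ∀ x y : Fin 3 → ℝ, 0 ≤ (x ⬝ᵥ S *ᵥ x) * (y ⬝ᵥ S *ᵥ y) := fun x y => by
    have h := cross_dotProduct_adjugate_mulVec_cross S hS x y
    have hnn : 0 ≤ (x ⨯₃ y) ⬝ᵥ S.adjugate *ᵥ (x ⨯₃ y) := by simpa using hadj.dotProduct_mulVec_nonneg (x ⨯₃ y)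
    nlinarith [sq_nonneg (x ⬝ᵥ S *ᵥ y)]
  have hH : S.IsHermitian := isHermitian_iff_isSymm.mpr hS
  by_cases hpos : ∃ x : Fin 3 → ℝ, 0 < x ⬝ᵥ S *ᵥ x
  · obtain ⟨x, hx⟩ := hpos
    left
    refine Matrix.PosSemidef.of_dotProduct_mulVec_nonneg hH fun y => ?_
    simp only [star_trivial]
    exact nonneg_of_mul_nonneg_right (gram x y) hx
  · right
    push Not at hpos
    refine Matrix.PosSemidef.of_dotProduct_mulVec_nonneg hH.neg fun y => ?_
    simp only [star_trivial, Matrix.neg_mulVec, dotProduct_neg]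
    linarith [hpos y]

/-- For `3 × 3` matrices `adj(−S) = adj S` (local copy). [folklore] -/
private theorem adjugate_neg_aux3 (S : Matrix (Fin 3) (Fin 3) ℝ) : (-S).adjugate = S.adjugate := by
  rw [← neg_one_smul ℝ S, Matrix.adjugate_smul]; simp

/-- **A singular symmetric letter in NO semidefinite cell has `−adj S ⪰ 0`** (the indefinite rank-two cell). [folklore] -/
theorem neg_adjugate_posSemidef_of_not_semidef (S : Matrix (Fin 3) (Fin 3) ℝ) (hS : S.IsSymm) (hdet : S.det = 0)
    (hp : ¬ S.PosSemidef) (hn : ¬ (-S).PosSemidef) : (-S.adjugate).PosSemidef := by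
  rcases adjugate_cell_of_det_eq_zero S hS hdet with h | h
  · rcases posSemidef_or_neg_of_adjugate_posSemidef S hS h with h' | h'
    · exact absurd h' hp
    · exact absurd h' hn
  · exact h

/-! ## 2. Sign facts for a definite letter against a singular end letter -/

/-- `N ≻ 0`, `P ⪰ 0` ⇒ `tr(adj N·P) ≥ 0`. [folklore] -/
theorem trace_adjugate_mul_nonneg_of_posDef_posSemidef {N P : Matrix (Fin 3) (Fin 3) ℝ} (hN : N.PosDef) (hP : P.PosSemidef) :
    0 ≤ (N.adjugate * P).trace :=
  trace_mul_nonneg_of_posSemidef_posSemidef (adjugate_posDef_of_posDef hN).posSemidef hP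

/-- `P ⪰ 0`, `N ≻ 0` ⇒ `tr(adj P·N) ≥ 0`. [folklore] -/
theorem trace_adjugate_mul_nonneg_of_posSemidef_posDef {N P : Matrix (Fin 3) (Fin 3) ℝ} (hP : P.PosSemidef) (hN : N.PosDef) :
    0 ≤ (P.adjugate * N).trace :=
  trace_mul_nonneg_of_posSemidef_posSemidef (adjugate_posSemidef_of_posSemidef hP) hN.posSemidef

/-- `−adj P ⪰ 0`, `N ≻ 0` ⇒ `tr(adj P·N) ≤ 0`. [folklore] -/
theorem trace_adjugate_mul_nonpos_of_negCell_posDef {N P : Matrix (Fin 3) (Fin 3) ℝ} (hP : (-P.adjugate).PosSemidef) (hN : N.PosDef) :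
    (P.adjugate * N).trace ≤ 0 := by
  have := trace_mul_nonneg_of_posSemidef_posSemidef hP hN.posSemidef
  rw [Matrix.neg_mul, Matrix.trace_neg] at this; linarith


/-! ## END-EDGE TEST read from the top end (`S_3 ⪰ 0`), edge towards `S_0` -/

/-- **END-EDGE TEST (top end pins, edge to `S_0`).**  Null-null sheet, `S_3 ⪰ 0`; middle letter `x` hidden-definite (orientation `0 < (−1)^{ρ(2d_x+d_E)}·c_{001}`,
`ρ(3d_x) ≡ ρ(2d_3+d_x)`); with `s = sign c_{33x}`: if `S_0 ⪰ 0` then `c_{xx0} > 0` and `sign c_{x00} = s`; if `S_0 ⪯ 0` then `c_{xx0} < 0` and `sign c_{x00} = s`;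
if `S_0` is indefinite then `sign c_{x00} = −s`.  A violated consequence ⇒ `Z₊ ≤ 16`. [folklore] -/
theorem card_posRoots_le_16_of_nullNull_topEndEdgeTest (d : Fin 4 → ℕ) (hd : StrictMono d) (S : Fin 4 → Matrix (Fin 3) (Fin 3) ℝ)
    (hS : ∀ l, (S l).IsSymm) (h0 : (S 0).det = 0) (h3 : (S 3).det = 0) (hpsd : (S 3).PosSemidef)
    (ρ : ℕ → ℕ) (hρ : ∀ n, ρ n = ((((((Finset.univ : Finset (Sym (Fin 4) 3)).erase (Sym.replicate 3 3)).erase (Sym.replicate 3 0)).image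
          (fun s : Sym (Fin 4) 3 => ((s : Multiset (Fin 4)).map d).sum)).filter (· < n)).card))
    {x : Fin 4} (hx0 : x ≠ 0) (hx3 : x ≠ 3)
    (hor : 0 < (-1 : ℝ) ^ ρ (2 * d x + d 3) * ((S 0).adjugate * S 1).trace)
    (hxdef : (ρ (3 * d x) + ρ (2 * d 3 + d x)) % 2 = 0)
    (hkill : ((S 0).PosSemidef ∧ ((-1 : ℝ) ^ ρ (2 * d x + d 0) * ((S 0).adjugate * S 1).trace < 0 ∨ ρ (2 * d 0 + d x) % 2 ≠ ρ (2 * d 3 + d x) % 2))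
      ∨ ((-S 0).PosSemidef ∧ (0 < (-1 : ℝ) ^ ρ (2 * d x + d 0) * ((S 0).adjugate * S 1).trace ∨ ρ (2 * d 0 + d x) % 2 ≠ ρ (2 * d 3 + d x) % 2))
      ∨ ((¬ (S 0).PosSemidef ∧ ¬ (-S 0).PosSemidef) ∧ ρ (2 * d 0 + d x) % 2 = ρ (2 * d 3 + d x) % 2)) :
    ((Matrix.det (∑ l, ((X : ℝ[X]) ^ d l) • (S l).map C)).roots.toFinset.filter (fun t => 0 < t)).card ≤ 16 := by
  by_contra hlt
  have h17 : 17 ≤ ((Matrix.det (∑ l, ((X : ℝ[X]) ^ d l) • (S l).map C)).roots.toFinset.filter (fun t => 0 < t)).card := by omega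
  have hρ' : ∀ n, ρ n = ((Matrix.det (∑ l, ((X : ℝ[X]) ^ d l) • (S l).map C)).support.filter (· < n)).card := fun n => by rw [hρ, sheetRank_eq_of_nullNull_seventeen d S h0 h3 h17]
  have hqx := top_square_pos_of_orientation_nullNull d hd S h0 h3 h17 hx3 ρ hρ' hor
  obtain ⟨hxd, hxiff⟩ := hiddenDefinite_top_of_parity_nullNull d hd S hS h0 h3 hpsd h17 hx0 hx3 ρ hρ' hqx hxdef
  obtain ⟨cTx, mTx⟩ := coeff_square_of_nullNull_seventeen d hd S h0 h3 h17 3 x hx3.symm      -- c_{33x}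
  obtain ⟨cxxe, mxxe⟩ := coeff_square_of_nullNull_seventeen d hd S h0 h3 h17 x 0 hx0      -- c_{xx0}
  obtain ⟨cxee, mxee⟩ := coeff_square_of_nullNull_seventeen d hd S h0 h3 h17 0 x hx0.symm -- c_{x00}
  obtain ⟨c01, m01⟩ := coeff_square_of_nullNull_seventeen d hd S h0 h3 h17 0 1 (by decide)
  have hrank0 := rank_subbottom_of_nullNull_seventeen d hd S h0 h3 h17
  -- sign of `c_{xx0}` versus the orientation; sign of `c_{x00}` versus `c_{33x}`
  have rA := coeff_mul_coeff_sign_of_nullNull_seventeen d S h0 h3 h17 m01 mxxe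
  rw [c01, cxxe, hrank0, zero_add, ← hρ'] at rA
  have rB := coeff_mul_coeff_sign_of_nullNull_seventeen d S h0 h3 h17 mxee mTx
  rw [cxee, cTx, ← hρ', ← hρ'] at rB
  have nzA := trace_adjugate_mul_ne_zero_of_nullNull_seventeen d hd S h0 h3 h17 x 0 hx0
  have nzB := trace_adjugate_mul_ne_zero_of_nullNull_seventeen d hd S h0 h3 h17 0 x hx0.symm
  have nzT := trace_adjugate_mul_ne_zero_of_nullNull_seventeen d hd S h0 h3 h17 3 x hx3.symm
  -- absolute sign of `c_{xx0}` from `(−1)^ρ·c_{001}`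
  -- the definite letter: `N = S_x` or `N = −S_x`
  rcases hxd with hP | hN
  · -- `S_x ≻ 0`, `s = +` (so `c_{33x} > 0`)
    have hT : 0 < ((S 3).adjugate * S x).trace := hxiff.mp hP
    rcases hkill with ⟨hpe, hk⟩ | ⟨hne, hk⟩ | ⟨⟨hnp, hnn⟩, hk⟩
    · have a1 : 0 < ((S x).adjugate * S 0).trace := lt_of_le_of_ne (trace_adjugate_mul_nonneg_of_posDef_posSemidef hP hpe) nzA.symm
      have b1 : 0 < ((S 0).adjugate * S x).trace := lt_of_le_of_ne (trace_adjugate_mul_nonneg_of_posSemidef_posDef hpe hP) nzB.symm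
      rcases hk with hk | hk
      · rcases Nat.mod_two_eq_zero_or_one (ρ (2 * d x + d 0)) with p | p
        · have := rA.1 p; rw [neg_one_pow_eq_pow_mod_two, p, pow_zero, one_mul] at hk; nlinarith [this, hk, a1]
        · have := rA.2 p; rw [neg_one_pow_eq_pow_mod_two, p, pow_one, neg_one_mul, neg_lt_zero] at hk; nlinarith [this, hk, a1]
      · have := rB.2 (by omega); nlinarith [this, b1, hT]
    · have a1 : ((S x).adjugate * S 0).trace < 0 := by
        have := trace_adjugate_mul_nonneg_of_posDef_posSemidef hP hne
        rw [Matrix.mul_neg, Matrix.trace_neg] at this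
        exact lt_of_le_of_ne (by linarith) nzA
      have b1 : 0 < ((S 0).adjugate * S x).trace := by
        have := trace_adjugate_mul_nonneg_of_posSemidef_posDef hne hP
        rw [adjugate_neg_aux3] at this; exact lt_of_le_of_ne this nzB.symm
      rcases hk with hk | hk
      · rcases Nat.mod_two_eq_zero_or_one (ρ (2 * d x + d 0)) with p | p
        · have := rA.1 p; rw [neg_one_pow_eq_pow_mod_two, p, pow_zero, one_mul] at hk; nlinarith [this, hk, a1]
        · have := rA.2 p; rw [neg_one_pow_eq_pow_mod_two, p, pow_one, neg_one_mul, neg_pos] at hk; nlinarith [this, hk, a1]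
      · have := rB.2 (by omega); nlinarith [this, b1, hT]
    · have hcell := neg_adjugate_posSemidef_of_not_semidef (S 0) (hS 0) (by exact h0) hnp hnn
      have b1 : ((S 0).adjugate * S x).trace < 0 := lt_of_le_of_ne (trace_adjugate_mul_nonpos_of_negCell_posDef hcell hP) nzB
      have := rB.1 (by omega); nlinarith [this, b1, hT]
  · -- `S_x ≺ 0`, `s = −` (so `c_{33x} < 0`)
    have hT : ((S 3).adjugate * S x).trace < 0 := by
      rcases lt_or_gt_of_ne nzT with h | h
      · exact h
      · exact absurd (hxiff.mpr h) (not_posDef_of_neg_posDef hN)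
    rcases hkill with ⟨hpe, hk⟩ | ⟨hne, hk⟩ | ⟨⟨hnp, hnn⟩, hk⟩
    · have a1 : 0 < ((S x).adjugate * S 0).trace := by
        have := trace_adjugate_mul_nonneg_of_posDef_posSemidef hN hpe
        rw [adjugate_neg_aux3] at this; exact lt_of_le_of_ne this nzA.symm
      have b1 : ((S 0).adjugate * S x).trace < 0 := by
        have := trace_adjugate_mul_nonneg_of_posSemidef_posDef hpe hN
        rw [Matrix.mul_neg, Matrix.trace_neg] at this; exact lt_of_le_of_ne (by linarith) nzB
      rcases hk with hk | hk
      · rcases Nat.mod_two_eq_zero_or_one (ρ (2 * d x + d 0)) with p | p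
        · have := rA.1 p; rw [neg_one_pow_eq_pow_mod_two, p, pow_zero, one_mul] at hk; nlinarith [this, hk, a1]
        · have := rA.2 p; rw [neg_one_pow_eq_pow_mod_two, p, pow_one, neg_one_mul, neg_lt_zero] at hk; nlinarith [this, hk, a1]
      · have := rB.2 (by omega); nlinarith [this, b1, hT]
    · have a1 : ((S x).adjugate * S 0).trace < 0 := by
        have := trace_adjugate_mul_nonneg_of_posDef_posSemidef hN hne
        rw [adjugate_neg_aux3, Matrix.mul_neg, Matrix.trace_neg] at this; exact lt_of_le_of_ne (by linarith) nzA
      have b1 : ((S 0).adjugate * S x).trace < 0 := by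
        have := trace_adjugate_mul_nonneg_of_posSemidef_posDef hne hN
        rw [adjugate_neg_aux3, Matrix.mul_neg, Matrix.trace_neg] at this; exact lt_of_le_of_ne (by linarith) nzB
      rcases hk with hk | hk
      · rcases Nat.mod_two_eq_zero_or_one (ρ (2 * d x + d 0)) with p | p
        · have := rA.1 p; rw [neg_one_pow_eq_pow_mod_two, p, pow_zero, one_mul] at hk; nlinarith [this, hk, a1]
        · have := rA.2 p; rw [neg_one_pow_eq_pow_mod_two, p, pow_one, neg_one_mul, neg_pos] at hk; nlinarith [this, hk, a1]
      · have := rB.2 (by omega); nlinarith [this, b1, hT]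
    · have hcell := neg_adjugate_posSemidef_of_not_semidef (S 0) (hS 0) (by exact h0) hnp hnn
      have b1 : 0 < ((S 0).adjugate * S x).trace := by
        have := trace_adjugate_mul_nonpos_of_negCell_posDef hcell hN
        rw [Matrix.mul_neg, Matrix.trace_neg] at this; exact lt_of_le_of_ne (by linarith) nzB.symm
      have := rB.1 (by omega); nlinarith [this, b1, hT]

/-! ## END-EDGE TEST read from the bottom end (`S_0 ⪰ 0`), edge towards `S_3` -/

/-- **END-EDGE TEST (bottom end pins, edge to `S_3`).**  Null-null sheet, `S_0 ⪰ 0`; middle letter `x` hidden-definite (orientation `0 < (−1)^{ρ(2d_x+d_E)}·c_{001}`,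
`ρ(3d_x) ≡ ρ(2d_0+d_x)`); with `s = sign c_{00x}`: if `S_3 ⪰ 0` then `c_{xx3} > 0` and `sign c_{x33} = s`; if `S_3 ⪯ 0` then `c_{xx3} < 0` and `sign c_{x33} = s`;
if `S_3` is indefinite then `sign c_{x33} = −s`.  A violated consequence ⇒ `Z₊ ≤ 16`. [folklore] -/
theorem card_posRoots_le_16_of_nullNull_bottomEndEdgeTest (d : Fin 4 → ℕ) (hd : StrictMono d) (S : Fin 4 → Matrix (Fin 3) (Fin 3) ℝ)
    (hS : ∀ l, (S l).IsSymm) (h0 : (S 0).det = 0) (h3 : (S 3).det = 0) (hpsd : (S 0).PosSemidef)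
    (ρ : ℕ → ℕ) (hρ : ∀ n, ρ n = ((((((Finset.univ : Finset (Sym (Fin 4) 3)).erase (Sym.replicate 3 3)).erase (Sym.replicate 3 0)).image
          (fun s : Sym (Fin 4) 3 => ((s : Multiset (Fin 4)).map d).sum)).filter (· < n)).card))
    {x : Fin 4} (hx0 : x ≠ 0) (hx3 : x ≠ 3)
    (hor : 0 < (-1 : ℝ) ^ ρ (2 * d x + d 0) * ((S 0).adjugate * S 1).trace)
    (hxdef : (ρ (3 * d x) + ρ (2 * d 0 + d x)) % 2 = 0)
    (hkill : ((S 3).PosSemidef ∧ ((-1 : ℝ) ^ ρ (2 * d x + d 3) * ((S 0).adjugate * S 1).trace < 0 ∨ ρ (2 * d 3 + d x) % 2 ≠ ρ (2 * d 0 + d x) % 2))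
      ∨ ((-S 3).PosSemidef ∧ (0 < (-1 : ℝ) ^ ρ (2 * d x + d 3) * ((S 0).adjugate * S 1).trace ∨ ρ (2 * d 3 + d x) % 2 ≠ ρ (2 * d 0 + d x) % 2))
      ∨ ((¬ (S 3).PosSemidef ∧ ¬ (-S 3).PosSemidef) ∧ ρ (2 * d 3 + d x) % 2 = ρ (2 * d 0 + d x) % 2)) :
    ((Matrix.det (∑ l, ((X : ℝ[X]) ^ d l) • (S l).map C)).roots.toFinset.filter (fun t => 0 < t)).card ≤ 16 := by
  by_contra hlt
  have h17 : 17 ≤ ((Matrix.det (∑ l, ((X : ℝ[X]) ^ d l) • (S l).map C)).roots.toFinset.filter (fun t => 0 < t)).card := by omega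
  have hρ' : ∀ n, ρ n = ((Matrix.det (∑ l, ((X : ℝ[X]) ^ d l) • (S l).map C)).support.filter (· < n)).card := fun n => by rw [hρ, sheetRank_eq_of_nullNull_seventeen d S h0 h3 h17]
  have hqx := bottom_square_pos_of_orientation_nullNull d hd S h0 h3 h17 hx0 ρ hρ' hor
  obtain ⟨hxd, hxiff⟩ := hiddenDefinite_bottom_of_parity_nullNull d hd S hS h0 h3 hpsd h17 hx0 hx3 ρ hρ' hqx hxdef
  obtain ⟨cTx, mTx⟩ := coeff_square_of_nullNull_seventeen d hd S h0 h3 h17 0 x hx0.symm      -- c_{00x}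
  obtain ⟨cxxe, mxxe⟩ := coeff_square_of_nullNull_seventeen d hd S h0 h3 h17 x 3 hx3      -- c_{xx3}
  obtain ⟨cxee, mxee⟩ := coeff_square_of_nullNull_seventeen d hd S h0 h3 h17 3 x hx3.symm -- c_{x33}
  obtain ⟨c01, m01⟩ := coeff_square_of_nullNull_seventeen d hd S h0 h3 h17 0 1 (by decide)
  have hrank0 := rank_subbottom_of_nullNull_seventeen d hd S h0 h3 h17
  -- sign of `c_{xx3}` versus the orientation; sign of `c_{x33}` versus `c_{00x}`
  have rA := coeff_mul_coeff_sign_of_nullNull_seventeen d S h0 h3 h17 m01 mxxe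
  rw [c01, cxxe, hrank0, zero_add, ← hρ'] at rA
  have rB := coeff_mul_coeff_sign_of_nullNull_seventeen d S h0 h3 h17 mxee mTx
  rw [cxee, cTx, ← hρ', ← hρ'] at rB
  have nzA := trace_adjugate_mul_ne_zero_of_nullNull_seventeen d hd S h0 h3 h17 x 3 hx3
  have nzB := trace_adjugate_mul_ne_zero_of_nullNull_seventeen d hd S h0 h3 h17 3 x hx3.symm
  have nzT := trace_adjugate_mul_ne_zero_of_nullNull_seventeen d hd S h0 h3 h17 0 x hx0.symm
  -- absolute sign of `c_{xx3}` from `(−1)^ρ·c_{001}`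
  -- the definite letter: `N = S_x` or `N = −S_x`
  rcases hxd with hP | hN
  · -- `S_x ≻ 0`, `s = +` (so `c_{00x} > 0`)
    have hT : 0 < ((S 0).adjugate * S x).trace := hxiff.mp hP
    rcases hkill with ⟨hpe, hk⟩ | ⟨hne, hk⟩ | ⟨⟨hnp, hnn⟩, hk⟩
    · have a1 : 0 < ((S x).adjugate * S 3).trace := lt_of_le_of_ne (trace_adjugate_mul_nonneg_of_posDef_posSemidef hP hpe) nzA.symm
      have b1 : 0 < ((S 3).adjugate * S x).trace := lt_of_le_of_ne (trace_adjugate_mul_nonneg_of_posSemidef_posDef hpe hP) nzB.symm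
      rcases hk with hk | hk
      · rcases Nat.mod_two_eq_zero_or_one (ρ (2 * d x + d 3)) with p | p
        · have := rA.1 p; rw [neg_one_pow_eq_pow_mod_two, p, pow_zero, one_mul] at hk; nlinarith [this, hk, a1]
        · have := rA.2 p; rw [neg_one_pow_eq_pow_mod_two, p, pow_one, neg_one_mul, neg_lt_zero] at hk; nlinarith [this, hk, a1]
      · have := rB.2 (by omega); nlinarith [this, b1, hT]
    · have a1 : ((S x).adjugate * S 3).trace < 0 := by
        have := trace_adjugate_mul_nonneg_of_posDef_posSemidef hP hne
        rw [Matrix.mul_neg, Matrix.trace_neg] at this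
        exact lt_of_le_of_ne (by linarith) nzA
      have b1 : 0 < ((S 3).adjugate * S x).trace := by
        have := trace_adjugate_mul_nonneg_of_posSemidef_posDef hne hP
        rw [adjugate_neg_aux3] at this; exact lt_of_le_of_ne this nzB.symm
      rcases hk with hk | hk
      · rcases Nat.mod_two_eq_zero_or_one (ρ (2 * d x + d 3)) with p | p
        · have := rA.1 p; rw [neg_one_pow_eq_pow_mod_two, p, pow_zero, one_mul] at hk; nlinarith [this, hk, a1]
        · have := rA.2 p; rw [neg_one_pow_eq_pow_mod_two, p, pow_one, neg_one_mul, neg_pos] at hk; nlinarith [this, hk, a1]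
      · have := rB.2 (by omega); nlinarith [this, b1, hT]
    · have hcell := neg_adjugate_posSemidef_of_not_semidef (S 3) (hS 3) (by exact h3) hnp hnn
      have b1 : ((S 3).adjugate * S x).trace < 0 := lt_of_le_of_ne (trace_adjugate_mul_nonpos_of_negCell_posDef hcell hP) nzB
      have := rB.1 (by omega); nlinarith [this, b1, hT]
  · -- `S_x ≺ 0`, `s = −` (so `c_{00x} < 0`)
    have hT : ((S 0).adjugate * S x).trace < 0 := by
      rcases lt_or_gt_of_ne nzT with h | h
      · exact h
      · exact absurd (hxiff.mpr h) (not_posDef_of_neg_posDef hN)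
    rcases hkill with ⟨hpe, hk⟩ | ⟨hne, hk⟩ | ⟨⟨hnp, hnn⟩, hk⟩
    · have a1 : 0 < ((S x).adjugate * S 3).trace := by
        have := trace_adjugate_mul_nonneg_of_posDef_posSemidef hN hpe
        rw [adjugate_neg_aux3] at this; exact lt_of_le_of_ne this nzA.symm
      have b1 : ((S 3).adjugate * S x).trace < 0 := by
        have := trace_adjugate_mul_nonneg_of_posSemidef_posDef hpe hN
        rw [Matrix.mul_neg, Matrix.trace_neg] at this; exact lt_of_le_of_ne (by linarith) nzB
      rcases hk with hk | hk
      · rcases Nat.mod_two_eq_zero_or_one (ρ (2 * d x + d 3)) with p | p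
        · have := rA.1 p; rw [neg_one_pow_eq_pow_mod_two, p, pow_zero, one_mul] at hk; nlinarith [this, hk, a1]
        · have := rA.2 p; rw [neg_one_pow_eq_pow_mod_two, p, pow_one, neg_one_mul, neg_lt_zero] at hk; nlinarith [this, hk, a1]
      · have := rB.2 (by omega); nlinarith [this, b1, hT]
    · have a1 : ((S x).adjugate * S 3).trace < 0 := by
        have := trace_adjugate_mul_nonneg_of_posDef_posSemidef hN hne
        rw [adjugate_neg_aux3, Matrix.mul_neg, Matrix.trace_neg] at this; exact lt_of_le_of_ne (by linarith) nzA
      have b1 : ((S 3).adjugate * S x).trace < 0 := by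
        have := trace_adjugate_mul_nonneg_of_posSemidef_posDef hne hN
        rw [adjugate_neg_aux3, Matrix.mul_neg, Matrix.trace_neg] at this; exact lt_of_le_of_ne (by linarith) nzB
      rcases hk with hk | hk
      · rcases Nat.mod_two_eq_zero_or_one (ρ (2 * d x + d 3)) with p | p
        · have := rA.1 p; rw [neg_one_pow_eq_pow_mod_two, p, pow_zero, one_mul] at hk; nlinarith [this, hk, a1]
        · have := rA.2 p; rw [neg_one_pow_eq_pow_mod_two, p, pow_one, neg_one_mul, neg_pos] at hk; nlinarith [this, hk, a1]
      · have := rB.2 (by omega); nlinarith [this, b1, hT]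
    · have hcell := neg_adjugate_posSemidef_of_not_semidef (S 3) (hS 3) (by exact h3) hnp hnn
      have b1 : 0 < ((S 3).adjugate * S x).trace := by
        have := trace_adjugate_mul_nonpos_of_negCell_posDef hcell hN
        rw [Matrix.mul_neg, Matrix.trace_neg] at this; exact lt_of_le_of_ne (by linarith) nzB.symm
      have := rB.1 (by omega); nlinarith [this, b1, hT]

end Summit.ValiantsHypothesis.ValiantsHypothesis.Theorems.LacunarySymmetroidMatrixDescartes.Census
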